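import Literature.Combinatorics.Sahi2008.ProvedCases

/-!
# `NoHeavyLowerTail` (crux stmt-CriticalPhenomena-4575), Sahi programme: **A QUANTITATIVE `C₃` FOR PRINCIPAL UP-SETS** —
# `E₃(χ_A, χ_B, χ_C) ≥ ½ · (μ(A∩B∩C) − μ(A)μ(B)μ(C))` for threshold (cylinder) events under a product measure, `½` sharp

Support file (Sahi cell, seat `prim-sahi-p1`, generation 48; `--supports stmt-CriticalPhenomena-4575`).  Pure proofs, standard axioms, no
`sorry`; the only definitions are the bookkeeping `mid3` (the middle of three reals), `tail` (upper tail of a chain weight) and `cyl` (the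
principal up-set / cylinder `{x ≥ a}` of a grid).

THE QUESTION (prim-sahi-p2 gen 33, memo FROM-prim-sahi-p2-gen33-TWO-LEVEL-ORACLE §8, ask to p1/typer): is there a 'quantitative `C₃`'
`E₃(f,g,h) ≥ κ·(M_123 − M_1M_2M_3)` for PRINCIPAL up-sets on `{0,1}^m` / grids (`κ = 1` being the shape of the percolation target K_avg)?
THE ANSWER (this file).  For principal up-sets `A = {x ≥ a}`, `B = {x ≥ b}`, `C = {x ≥ c}` of a grid `[K+1]^d` under ANY product probability
weight: **`κ = ½` holds and is best possible** — `κ = 1` fails already for `A = B = C` (`E₃(χ_S,χ_S,χ_S)/(μ(S) − μ(S)³) = (2 − s)/(1 + s) → ½`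
as `s = μ(S) → 1`).  Precisely (`two_mul_latticeE3_cyl_ge`):
  `2·E₃(χ_A,χ_B,χ_C) − (μ(ABC) − μ(A)μ(B)μ(C)) ≥ μ(ABC)·[3(1 − W)² + (W − V)(4 − 3W)] ≥ 0`,
where, writing `u_i, v_i, w_i ∈ [0,1]` for the upper-tail probabilities of the thresholds `a_i, b_i, c_i` in coordinate `i` (so that every
joint moment is a product of coordinatewise minima: `μ(A∩B) = ∏_i min(u_i, v_i)`, …), `V = ∏_i mid(u_i,v_i,w_i)` and `W = ∏_i max(u_i,v_i,w_i)`.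
PROOF (elementary, `quantC3_core`): with `T = ∏ min`, the three mixed products `X = μ(A)μ(BC)`, `Y`, `Z` satisfy coordinatewise
`{x_i, y_i, z_i} = {t_i m_i, t_i m_i, t_i M_i}` (`t,m,M` = min, mid, max), hence `TV ≤ X,Y,Z ≤ TW` and, by induction on the coordinates,
`X + Y + Z ≤ 2·TV + TW` (`sum_mixed_le`); and `μ(A)μ(B)μ(C) = TVW`.  So `3T − 2(X+Y+Z) + 3TVW ≥ T(3 − 4V − 2W + 3VW) = T[3(1−W)² + (W−V)(4−3W)]`.
The same statement holds verbatim for threshold events on any finite product of finite chains (embed each chain in `Fin (K+1)`); on `{0,1}^m`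
these are the cylinder events 'all coordinates of `S` equal 1'.  For UNIONS of principal up-sets no `κ > 0` works uniformly (p2 gen 4);
`κ = ½` is the lattice-side constant of p2's 'E₃ ≥ ½Φ'.  Sahi's `C₃` for one principal slot and any FKG weight (`κ = 0`) is the tree's
`Literature.Probability.LatticeModels.latticeE3_nonneg_of_principal` (Sahi 2008 Thm 2 / Blinovsky 2013). [this work]
-/

namespace Summit.CriticalPhenomena.PercolationContinuityZ3.Theorems.SahiQuantC3

open Finset Literature.Probability.LatticeModels Literature.Combinatorics.Sahi2008
open scoped BigOperators

noncomputable section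

/-! ### Three reals: min, middle, max -/

section Three

/-- The middle one of three reals: the largest of the pairwise minima. [this work] -/
def mid3 (u v w : ℝ) : ℝ := max (min u v) (max (min u w) (min v w))

variable (u v w : ℝ)

/-- **Sorting three reals**: `(min, mid3, max)` is one of the six permutations of `(u, v, w)`, in increasing order. [this work] -/
theorem sort3 :
    (min u (min v w) = u ∧ mid3 u v w = v ∧ max u (max v w) = w ∧ u ≤ v ∧ v ≤ w) ∨
    (min u (min v w) = u ∧ mid3 u v w = w ∧ max u (max v w) = v ∧ u ≤ w ∧ w ≤ v) ∨
    (min u (min v w) = v ∧ mid3 u v w = u ∧ max u (max v w) = w ∧ v ≤ u ∧ u ≤ w) ∨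
    (min u (min v w) = v ∧ mid3 u v w = w ∧ max u (max v w) = u ∧ v ≤ w ∧ w ≤ u) ∨
    (min u (min v w) = w ∧ mid3 u v w = u ∧ max u (max v w) = v ∧ w ≤ u ∧ u ≤ v) ∨
    (min u (min v w) = w ∧ mid3 u v w = v ∧ max u (max v w) = u ∧ w ≤ v ∧ v ≤ u) := by
  unfold mid3
  rcases le_total u v with h1 | h1 <;> rcases le_total v w with h2 | h2 <;> rcases le_total u w with h3 | h3
  · refine Or.inl ⟨?_, ?_, ?_, h1, h2⟩ <;> simp only [min_def, max_def] <;> split_ifs <;> linarith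
  · refine Or.inl ⟨?_, ?_, ?_, h1, h2⟩ <;> simp only [min_def, max_def] <;> split_ifs <;> linarith
  · refine Or.inr (Or.inl ⟨?_, ?_, ?_, h3, h2⟩) <;> simp only [min_def, max_def] <;> split_ifs <;> linarith
  · refine Or.inr (Or.inr (Or.inr (Or.inr (Or.inl ⟨?_, ?_, ?_, h3, h1⟩)))) <;> simp only [min_def, max_def] <;>
      split_ifs <;> linarith
  · refine Or.inr (Or.inr (Or.inl ⟨?_, ?_, ?_, h1, h3⟩)) <;> simp only [min_def, max_def] <;> split_ifs <;> linarith
  · refine Or.inr (Or.inr (Or.inr (Or.inl ⟨?_, ?_, ?_, h2, h3⟩))) <;> simp only [min_def, max_def] <;> split_ifs <;> linarith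
  · refine Or.inr (Or.inr (Or.inl ⟨?_, ?_, ?_, h1, h3⟩)) <;> simp only [min_def, max_def] <;> split_ifs <;> linarith
  · refine Or.inr (Or.inr (Or.inr (Or.inr (Or.inr ⟨?_, ?_, ?_, h2, h1⟩)))) <;> simp only [min_def, max_def] <;>
      split_ifs <;> linarith

/-- `min ≤ mid`. [this work] -/
theorem min3_le_mid3 : min u (min v w) ≤ mid3 u v w := by
  rcases sort3 u v w with ⟨ht, hm, -, h1, -⟩ | ⟨ht, hm, -, h1, -⟩ | ⟨ht, hm, -, h1, -⟩ | ⟨ht, hm, -, h1, -⟩ |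
    ⟨ht, hm, -, h1, -⟩ | ⟨ht, hm, -, h1, -⟩ <;> rw [ht, hm] <;> exact h1

/-- `mid ≤ max`. [this work] -/
theorem mid3_le_max3 : mid3 u v w ≤ max u (max v w) := by
  rcases sort3 u v w with ⟨-, hm, hM, -, h2⟩ | ⟨-, hm, hM, -, h2⟩ | ⟨-, hm, hM, -, h2⟩ | ⟨-, hm, hM, -, h2⟩ |
    ⟨-, hm, hM, -, h2⟩ | ⟨-, hm, hM, -, h2⟩ <;> rw [hm, hM] <;> exact h2

/-- `min · mid · max = u · v · w`. [this work] -/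
theorem min3_mul_mid3_mul_max3 : min u (min v w) * mid3 u v w * max u (max v w) = u * v * w := by
  rcases sort3 u v w with ⟨ht, hm, hM, -, -⟩ | ⟨ht, hm, hM, -, -⟩ | ⟨ht, hm, hM, -, -⟩ | ⟨ht, hm, hM, -, -⟩ |
    ⟨ht, hm, hM, -, -⟩ | ⟨ht, hm, hM, -, -⟩ <;> rw [ht, hm, hM] <;> ring

/-- **The three mixed coordinate factors** `u·min(v,w)`, `v·min(u,w)`, `w·min(u,v)` all lie in `[min·mid, min·max]` (for nonnegative reals),
and they sum to `min·(2·mid + max)`. [this work] -/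
theorem mixed_facts (hu : 0 ≤ u) (hv : 0 ≤ v) (hw : 0 ≤ w) :
    (min u (min v w) * mid3 u v w ≤ u * min v w ∧ min u (min v w) * mid3 u v w ≤ v * min u w ∧
        min u (min v w) * mid3 u v w ≤ w * min u v) ∧
      (u * min v w ≤ min u (min v w) * max u (max v w) ∧ v * min u w ≤ min u (min v w) * max u (max v w) ∧
        w * min u v ≤ min u (min v w) * max u (max v w)) ∧
      u * min v w + v * min u w + w * min u v = min u (min v w) * (2 * mid3 u v w + max u (max v w)) := by
  rcases sort3 u v w with ⟨ht, hm, hM, h1, h2⟩ | ⟨ht, hm, hM, h1, h2⟩ | ⟨ht, hm, hM, h1, h2⟩ | ⟨ht, hm, hM, h1, h2⟩ |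
    ⟨ht, hm, hM, h1, h2⟩ | ⟨ht, hm, hM, h1, h2⟩ <;> rw [ht, hm, hM] <;>
    simp only [min_eq_left h1, min_eq_right h1, min_eq_left h2, min_eq_right h2, min_eq_left (h1.trans h2),
      min_eq_right (h1.trans h2)] <;>
    refine ⟨⟨?_, ?_, ?_⟩, ⟨?_, ?_, ?_⟩, by ring⟩ <;>
    nlinarith [mul_le_mul_of_nonneg_left h1 hu, mul_le_mul_of_nonneg_left h1 hv, mul_le_mul_of_nonneg_left h1 hw,
      mul_le_mul_of_nonneg_left h2 hu, mul_le_mul_of_nonneg_left h2 hv, mul_le_mul_of_nonneg_left h2 hw,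
      mul_le_mul_of_nonneg_left (h1.trans h2) hu, mul_le_mul_of_nonneg_left (h1.trans h2) hv,
      mul_le_mul_of_nonneg_left (h1.trans h2) hw]

end Three

/-! ### The core inequality over a finite set of coordinates -/

section Core

variable {ι : Type*} (u v w : ι → ℝ)

/-- The three mixed products `(∏ u)(∏ min(v,w))`, `(∏ v)(∏ min(u,w))`, `(∏ w)(∏ min(u,v))` are each at most `(∏ min)(∏ max)`. [this work] -/
theorem mixed_le_TW (s : Finset ι) (hu : ∀ i, 0 ≤ u i) (hv : ∀ i, 0 ≤ v i) (hw : ∀ i, 0 ≤ w i) :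
    (∏ i ∈ s, u i) * (∏ i ∈ s, min (v i) (w i)) ≤
        (∏ i ∈ s, min (u i) (min (v i) (w i))) * ∏ i ∈ s, max (u i) (max (v i) (w i)) ∧
      (∏ i ∈ s, v i) * (∏ i ∈ s, min (u i) (w i)) ≤
        (∏ i ∈ s, min (u i) (min (v i) (w i))) * ∏ i ∈ s, max (u i) (max (v i) (w i)) ∧
      (∏ i ∈ s, w i) * (∏ i ∈ s, min (u i) (v i)) ≤
        (∏ i ∈ s, min (u i) (min (v i) (w i))) * ∏ i ∈ s, max (u i) (max (v i) (w i)) := by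
  refine ⟨?_, ?_, ?_⟩ <;> rw [← prod_mul_distrib, ← prod_mul_distrib]
  · exact prod_le_prod (fun i _ => mul_nonneg (hu i) (le_min (hv i) (hw i)))
      fun i _ => (mixed_facts (u i) (v i) (w i) (hu i) (hv i) (hw i)).2.1.1
  · exact prod_le_prod (fun i _ => mul_nonneg (hv i) (le_min (hu i) (hw i)))
      fun i _ => (mixed_facts (u i) (v i) (w i) (hu i) (hv i) (hw i)).2.1.2.1
  · exact prod_le_prod (fun i _ => mul_nonneg (hw i) (le_min (hu i) (hv i)))
      fun i _ => (mixed_facts (u i) (v i) (w i) (hu i) (hv i) (hw i)).2.1.2.2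

/-- **The sum of the three mixed products is at most `2·(∏min)(∏mid) + (∏min)(∏max)`** (induction on the coordinates). [this work] -/
theorem sum_mixed_le [DecidableEq ι] (s : Finset ι) (hu : ∀ i, 0 ≤ u i) (hv : ∀ i, 0 ≤ v i) (hw : ∀ i, 0 ≤ w i) :
    (∏ i ∈ s, u i) * (∏ i ∈ s, min (v i) (w i)) + (∏ i ∈ s, v i) * (∏ i ∈ s, min (u i) (w i))
        + (∏ i ∈ s, w i) * (∏ i ∈ s, min (u i) (v i)) ≤
      2 * ((∏ i ∈ s, min (u i) (min (v i) (w i))) * ∏ i ∈ s, mid3 (u i) (v i) (w i))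
        + (∏ i ∈ s, min (u i) (min (v i) (w i))) * ∏ i ∈ s, max (u i) (max (v i) (w i)) := by
  induction s using Finset.induction_on with
  | empty => simp; norm_num
  | insert a s ha ih =>
    -- abbreviations for the old products
    set X := (∏ i ∈ s, u i) * ∏ i ∈ s, min (v i) (w i) with hX
    set Y := (∏ i ∈ s, v i) * ∏ i ∈ s, min (u i) (w i) with hY
    set Z := (∏ i ∈ s, w i) * ∏ i ∈ s, min (u i) (v i) with hZ
    set T := ∏ i ∈ s, min (u i) (min (v i) (w i)) with hT
    set V := ∏ i ∈ s, mid3 (u i) (v i) (w i) with hV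
    set W := ∏ i ∈ s, max (u i) (max (v i) (w i)) with hW
    -- the new coordinate
    set t := min (u a) (min (v a) (w a)) with ht
    set m := mid3 (u a) (v a) (w a) with hm
    set M := max (u a) (max (v a) (w a)) with hM
    set x := u a * min (v a) (w a) with hx
    set y := v a * min (u a) (w a) with hy
    set z := w a * min (u a) (v a) with hz
    have hTnn : 0 ≤ T := prod_nonneg fun i _ => le_min (hu i) (le_min (hv i) (hw i))
    have hWnn : 0 ≤ W := prod_nonneg fun i _ => le_trans (hu i) (le_max_left _ _)
    have htnn : 0 ≤ t := le_min (hu a) (le_min (hv a) (hw a))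
    have htm : t ≤ m := min3_le_mid3 _ _ _
    -- upper bounds of the old mixed products and the coordinate facts
    obtain ⟨hXle, hYle, hZle⟩ := mixed_le_TW u v w s hu hv hw
    obtain ⟨⟨hxb, hyb, hzb⟩, -, hsum⟩ := mixed_facts (u a) (v a) (w a) (hu a) (hv a) (hw a)
    -- rewrite the products over `insert a s`
    simp only [prod_insert ha]
    have goal_eq : u a * (∏ i ∈ s, u i) * (min (v a) (w a) * ∏ i ∈ s, min (v i) (w i))
          + v a * (∏ i ∈ s, v i) * (min (u a) (w a) * ∏ i ∈ s, min (u i) (w i))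
          + w a * (∏ i ∈ s, w i) * (min (u a) (v a) * ∏ i ∈ s, min (u i) (v i))
        = x * X + y * Y + z * Z := by
      simp only [hx, hy, hz, hX, hY, hZ]; ring
    rw [goal_eq]
    have rhs_eq : 2 * (t * T * (m * V)) + t * T * (M * W) = t * (2 * m * (T * V) + M * (T * W)) := by ring
    rw [rhs_eq]
    -- the estimate
    have key : x * X + y * Y + z * Z ≤ (x - t * m) * (T * W) + (y - t * m) * (T * W) + (z - t * m) * (T * W)
        + t * m * (X + Y + Z) := by
      nlinarith [mul_le_mul_of_nonneg_left hXle (sub_nonneg.2 hxb), mul_le_mul_of_nonneg_left hYle (sub_nonneg.2 hyb),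
        mul_le_mul_of_nonneg_left hZle (sub_nonneg.2 hzb)]
    have htm0 : 0 ≤ t * m := mul_nonneg htnn (htnn.trans htm)
    nlinarith [key, mul_le_mul_of_nonneg_left ih htm0, hsum, mul_nonneg hTnn hWnn]

/-- **The core inequality.**  For reals `u_i, v_i, w_i ∈ [0,1]`:
`2·[(∏u)(∏min(v,w)) + (∏v)(∏min(u,w)) + (∏w)(∏min(u,v))] ≤ 3·∏min(u,v,w) + 3·(∏u)(∏v)(∏w)`, indeed the difference is at least
`(∏min)·[3(1−W)² + (W−V)(4−3W)]` with `V = ∏ mid`, `W = ∏ max`. [this work] -/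
theorem quantC3_core [DecidableEq ι] (s : Finset ι) (hu : ∀ i, 0 ≤ u i) (hv : ∀ i, 0 ≤ v i) (hw : ∀ i, 0 ≤ w i)
    (hu1 : ∀ i, u i ≤ 1) (hv1 : ∀ i, v i ≤ 1) (hw1 : ∀ i, w i ≤ 1) :
    2 * ((∏ i ∈ s, u i) * (∏ i ∈ s, min (v i) (w i)) + (∏ i ∈ s, v i) * (∏ i ∈ s, min (u i) (w i))
        + (∏ i ∈ s, w i) * (∏ i ∈ s, min (u i) (v i))) ≤
      3 * (∏ i ∈ s, min (u i) (min (v i) (w i))) + 3 * ((∏ i ∈ s, u i) * (∏ i ∈ s, v i) * ∏ i ∈ s, w i) := by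
  have hS := sum_mixed_le u v w s hu hv hw
  set T := ∏ i ∈ s, min (u i) (min (v i) (w i)) with hT
  set V := ∏ i ∈ s, mid3 (u i) (v i) (w i) with hV
  set W := ∏ i ∈ s, max (u i) (max (v i) (w i)) with hW
  have hP : (∏ i ∈ s, u i) * (∏ i ∈ s, v i) * (∏ i ∈ s, w i) = T * V * W := by
    rw [hT, hV, hW, ← prod_mul_distrib, ← prod_mul_distrib, ← prod_mul_distrib, ← prod_mul_distrib]
    exact prod_congr rfl fun i _ => (min3_mul_mid3_mul_max3 (u i) (v i) (w i)).symm
  have hTnn : 0 ≤ T := prod_nonneg fun i _ => le_min (hu i) (le_min (hv i) (hw i))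
  have hVnn : 0 ≤ V := prod_nonneg fun i _ => le_trans (le_min (hu i) (le_min (hv i) (hw i))) (min3_le_mid3 _ _ _)
  have hVW : V ≤ W := prod_le_prod (fun i _ => le_trans (le_min (hu i) (le_min (hv i) (hw i))) (min3_le_mid3 _ _ _))
    fun i _ => mid3_le_max3 _ _ _
  have hW1 : W ≤ 1 := by
    rw [hW]
    calc (∏ i ∈ s, max (u i) (max (v i) (w i))) ≤ ∏ i ∈ s, (1 : ℝ) :=
          prod_le_prod (fun i _ => le_trans (hu i) (le_max_left _ _)) fun i _ => max_le (hu1 i) (max_le (hv1 i) (hw1 i))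
      _ = 1 := prod_const_one
  rw [hP]
  have hpoly : 0 ≤ 3 * (1 - W) ^ 2 + (W - V) * (4 - 3 * W) := by nlinarith
  nlinarith [mul_nonneg hTnn hpoly, hS]

end Core

/-! ### Principal up-sets of a grid under a product weight -/

section Grid

variable {d K : ℕ}

/-- The upper tail `Σ_{u ≥ t} g u` of a chain weight. [this work] -/
def tail (g : Fin (K + 1) → ℝ) (t : Fin (K + 1)) : ℝ := ∑ u ∈ univ.filter (fun u => t ≤ u), g u

/-- Tails of a nonnegative weight are nonnegative. [this work] -/
theorem tail_nonneg {g : Fin (K + 1) → ℝ} (hg : ∀ u, 0 ≤ g u) (t : Fin (K + 1)) : 0 ≤ tail g t :=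
  sum_nonneg fun u _ => hg u

/-- Tails of a probability weight are at most `1`. [this work] -/
theorem tail_le_one {g : Fin (K + 1) → ℝ} (hg : ∀ u, 0 ≤ g u) (hg1 : ∑ u, g u = 1) (t : Fin (K + 1)) : tail g t ≤ 1 := by
  unfold tail
  rw [← hg1]
  exact sum_le_sum_of_subset_of_nonneg (filter_subset _ _) fun u _ _ => hg u

/-- The tail is antitone in the threshold. [this work] -/
theorem tail_antitone {g : Fin (K + 1) → ℝ} (hg : ∀ u, 0 ≤ g u) : Antitone (tail g) := by
  intro s t hst
  unfold tail
  exact sum_le_sum_of_subset_of_nonneg (fun u hu => by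
    rw [mem_filter] at hu ⊢; exact ⟨hu.1, hst.trans hu.2⟩) fun u _ _ => hg u

/-- The principal up-set (cylinder) `{x : x ≥ a}` of the grid `[K+1]^d`. [this work] -/
def cyl (a : Fin d → Fin (K + 1)) : Finset (Fin d → Fin (K + 1)) := univ.filter fun x => ∀ i, a i ≤ x i

/-- Membership in a cylinder. [this work] -/
theorem mem_cyl {a x : Fin d → Fin (K + 1)} : x ∈ cyl a ↔ ∀ i, a i ≤ x i := by
  unfold cyl; simp

/-- Cylinders are up-sets. [this work] -/
theorem isUpperSet_cyl (a : Fin d → Fin (K + 1)) : IsUpperSet (cyl a : Set (Fin d → Fin (K + 1))) := by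
  intro x y hxy hx
  rw [Finset.mem_coe, mem_cyl] at hx ⊢
  exact fun i => (hx i).trans (hxy i)

/-- Intersections of cylinders are cylinders: `cyl a ∩ cyl b = cyl (a ⊔ b)`. [this work] -/
theorem cyl_inter (a b : Fin d → Fin (K + 1)) : cyl a ∩ cyl b = cyl (a ⊔ b) := by
  ext x
  simp only [mem_inter, mem_cyl, Pi.sup_apply, sup_le_iff]
  exact ⟨fun h i => ⟨h.1 i, h.2 i⟩, fun h => ⟨fun i => (h i).1, fun i => (h i).2⟩⟩

/-- **The mass of a cylinder under a product weight is the product of the tails.** [this work] -/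
theorem mass_cyl (g : Fin d → Fin (K + 1) → ℝ) (a : Fin d → Fin (K + 1)) :
    mass (fun ω : Fin d → Fin (K + 1) => ∏ i, g i (ω i)) (cyl a) = ∏ i, tail (g i) (a i) := by
  classical
  unfold mass tail
  rw [Finset.prod_univ_sum]
  refine sum_congr ?_ fun _ _ => rfl
  ext x
  rw [mem_cyl, Fintype.mem_piFinset]
  simp

/-- The tail at a join is the minimum of the tails. [this work] -/
theorem tail_sup {g : Fin (K + 1) → ℝ} (hg : ∀ u, 0 ≤ g u) (s t : Fin (K + 1)) :
    tail g (s ⊔ t) = min (tail g s) (tail g t) :=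
  (tail_antitone hg).map_max

/-- **A QUANTITATIVE `C₃` FOR PRINCIPAL UP-SETS (`κ = ½`).**  For every product probability weight `⊗ g_i` on the grid `[K+1]^d` and all
cylinders `A = cyl a`, `B = cyl b`, `C = cyl c`:
`μ(A∩B∩C) − μ(A)μ(B)μ(C) ≤ 2 · latticeE3 μ A B C` (= `2·E₃(χ_A,χ_B,χ_C)`, the weight having total mass `1`).  The constant `½` is sharp
(`A = B = C`, `μ(A) → 1`); `κ = 1` fails. [this work] -/
theorem two_mul_latticeE3_cyl_ge (g : Fin d → Fin (K + 1) → ℝ) (hg0 : ∀ i u, 0 ≤ g i u) (hg1 : ∀ i, ∑ u, g i u = 1)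
    (a b c : Fin d → Fin (K + 1)) :
    mass (fun ω : Fin d → Fin (K + 1) => ∏ i, g i (ω i)) (cyl a ∩ cyl b ∩ cyl c)
        - mass (fun ω : Fin d → Fin (K + 1) => ∏ i, g i (ω i)) (cyl a) * mass (fun ω : Fin d → Fin (K + 1) => ∏ i, g i (ω i)) (cyl b)
          * mass (fun ω : Fin d → Fin (K + 1) => ∏ i, g i (ω i)) (cyl c) ≤
      2 * latticeE3 (fun ω : Fin d → Fin (K + 1) => ∏ i, g i (ω i)) (cyl a) (cyl b) (cyl c) := by
  classical
  set μ : (Fin d → Fin (K + 1)) → ℝ := fun ω => ∏ i, g i (ω i) with hμ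
  have hZ : mass μ univ = 1 := by
    rw [mass_univ, hμ]
    simp only
    rw [← Fintype.prod_sum]; simp [hg1]
  -- all masses as products of coordinatewise minima of tails
  set u : Fin d → ℝ := fun i => tail (g i) (a i) with hu
  set v : Fin d → ℝ := fun i => tail (g i) (b i) with hv
  set w : Fin d → ℝ := fun i => tail (g i) (c i) with hw
  have hu0 : ∀ i, 0 ≤ u i := fun i => tail_nonneg (hg0 i) _
  have hv0 : ∀ i, 0 ≤ v i := fun i => tail_nonneg (hg0 i) _
  have hw0 : ∀ i, 0 ≤ w i := fun i => tail_nonneg (hg0 i) _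
  have hu1 : ∀ i, u i ≤ 1 := fun i => tail_le_one (hg0 i) (hg1 i) _
  have hv1 : ∀ i, v i ≤ 1 := fun i => tail_le_one (hg0 i) (hg1 i) _
  have hw1 : ∀ i, w i ≤ 1 := fun i => tail_le_one (hg0 i) (hg1 i) _
  have mA : mass μ (cyl a) = ∏ i, u i := mass_cyl g a
  have mB : mass μ (cyl b) = ∏ i, v i := mass_cyl g b
  have mC : mass μ (cyl c) = ∏ i, w i := mass_cyl g c
  have mAB : mass μ (cyl a ∩ cyl b) = ∏ i, min (u i) (v i) := by
    rw [cyl_inter, mass_cyl]; exact Fintype.prod_congr _ _ fun i => tail_sup (hg0 i) _ _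
  have mAC : mass μ (cyl a ∩ cyl c) = ∏ i, min (u i) (w i) := by
    rw [cyl_inter, mass_cyl]; exact Fintype.prod_congr _ _ fun i => tail_sup (hg0 i) _ _
  have mBC : mass μ (cyl b ∩ cyl c) = ∏ i, min (v i) (w i) := by
    rw [cyl_inter, mass_cyl]; exact Fintype.prod_congr _ _ fun i => tail_sup (hg0 i) _ _
  have mABC : mass μ (cyl a ∩ cyl b ∩ cyl c) = ∏ i, min (u i) (min (v i) (w i)) := by
    rw [cyl_inter, cyl_inter, mass_cyl]
    refine Fintype.prod_congr _ _ fun i => ?_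
    show tail (g i) ((a i ⊔ b i) ⊔ c i) = _
    rw [sup_assoc, tail_sup (hg0 i), tail_sup (hg0 i)]
  have core := quantC3_core u v w univ hu0 hv0 hw0 hu1 hv1 hw1
  unfold latticeE3
  rw [hZ, mABC, mA, mB, mC, mAB, mAC, mBC]
  nlinarith [core]

/-- **The same in Sahi's functional form**: for the product probability weight `μ = ⊗ g_i` on `[K+1]^d` and cylinders `A, B, C`,
`E[χ_Aχ_Bχ_C] − E[χ_A]E[χ_B]E[χ_C] ≤ 2 · E₃^{μ}(χ_A, χ_B, χ_C)`. [this work] -/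
theorem two_mul_sahiE_three_cyl_ge (g : Fin d → Fin (K + 1) → ℝ) (hg0 : ∀ i u, 0 ≤ g i u) (hg1 : ∀ i, ∑ u, g i u = 1)
    (a b c : Fin d → Fin (K + 1)) :
    mass (fun ω : Fin d → Fin (K + 1) => ∏ i, g i (ω i)) (cyl a ∩ cyl b ∩ cyl c)
        - mass (fun ω : Fin d → Fin (K + 1) => ∏ i, g i (ω i)) (cyl a) * mass (fun ω : Fin d → Fin (K + 1) => ∏ i, g i (ω i)) (cyl b)
          * mass (fun ω : Fin d → Fin (K + 1) => ∏ i, g i (ω i)) (cyl c) ≤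
      2 * sahiE (fun ω : Fin d → Fin (K + 1) => ∏ i, g i (ω i)) 3 ![setInd (cyl a), setInd (cyl b), setInd (cyl c)] := by
  classical
  have hsum : ∑ ω : Fin d → Fin (K + 1), ∏ i, g i (ω i) = 1 := by
    rw [← Fintype.prod_sum]; simp [hg1]
  rw [sahiE_three_indicator_eq_latticeE3 hsum]
  exact two_mul_latticeE3_cyl_ge g hg0 hg1 a b c

/-- **Sharpness of `½`**: for `A = B = C` of mass `s`, `2·latticeE3 − (μ(A) − μ(A)³) = 3s(1−s)²`, so no constant `κ > ½` works uniformly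
(take `s → 1`); stated as the exact identity for three equal sets under any weight of total mass `1`. [this work] -/
theorem two_mul_latticeE3_self_sub {α : Type*} [Fintype α] [DecidableEq α] {μ : α → ℝ} (hZ : mass μ univ = 1) (A : Finset α) :
    2 * latticeE3 μ A A A - (mass μ A - mass μ A * mass μ A * mass μ A) = 3 * mass μ A * (1 - mass μ A) ^ 2 := by
  unfold latticeE3
  rw [hZ, inter_self, inter_self]
  ring

end Grid

end

end Summit.CriticalPhenomena.PercolationContinuityZ3.Theorems.SahiQuantC3
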